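import Summits.Ventures.CertifiedArithmetic.LowPrec.OptTreeMixed
import Summits.Ventures.CertifiedArithmetic.LowPrec.OptTreeWitness

/-!
# OptTreeMixedWitness — Theorem T5(b): the node-weighted tree polynomial bound is attained (ties-to-even)

HONEST FRAMING: certified error envelopes and provably optimal rounding/accumulation schemes for
low-precision formats under stated cost models; every table by two implementations; no hardware or
vendor claims.

Companion of `LowPrec/OptTreeMixed.lean` (Theorem U-mixed: for every well-formed precision-labelled
tree, relative under-estimation `≤ 1 - 1/M_t`, `M_t` the node-weighted tree polynomial with
`u_p = 2^-p`).  Here: the bound is ATTAINED for every labelled shape whose labels are well formed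
(`LabelWF`: every precision `≥ 1`, never decreasing from a child addition to its parent), under any
family of rounding maps that round the binade midpoints `2^e (1 + u_p)` down to `2^e` (IEEE
roundTiesToEven does, `TiesEvenAtPow` of `OptTreeWitness`).

The witness `witP t e`: the root has scale `2^e`; at a node of precision `p` the child with the larger
node-weighted polynomial keeps the scale and the other child's scale drops by the factor `u_p = 2^-p`;
a leaf at scale `2^e'` is the float `2^e'`.  Every addition is then `2^e' + 2^e' u_p ↦ 2^e'`, the computed
root is `2^e`, the exact sum is `2^e · M_t`, so the under-estimation is exactly `(1 - 1/M_t) · exact`.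
The exponent range needed below the root scale is `dropP t` (the largest sum of precisions over the
light edges of a root-leaf path).

* `witP_spec` — the invariant; `mixedTreePoly_bound_attained` — attainment for every `LabelWF` tree;
* `exists_roundNearest_family_tiesEven` — a family of round-to-nearest maps into `F(p, emin)`, one per
  precision, each rounding the binade midpoints to even, exists;
* `R4_MixedTreePolySharp` (+ `_holds`) — Statement-style summary.  With
  `R4_MixedTreePolyUnderestimation` the worst-case relative under-estimation of every well-formed
  labelled tree under round-to-nearest-even is exactly `1 - 1/M_t` (certificate C15 confirms this by
  exhaustive dynamic programming for precision pairs (2,3), (2,4), (2,5), (3,4), (3,5) and the triple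
  (2,3,4), every labelled tree with up to 5–6 leaves).
-/

namespace Summit.Ventures.CertifiedArithmetic.LowPrec.Opt

open Literature.ComputerArithmetic.JeannerodRump2018

namespace PTree

/-- The node weights `u_p = 2^-p`. -/
noncomputable def U : ℕ → ℚ := fun p => unitRoundoff p

/-- `U p = 2^-p`. -/
@[simp] theorem U_apply (p : ℕ) : U p = unitRoundoff p := rfl

/-- Label condition of a subtree below an addition of precision `p` (values ignored). -/
def LabOK (p : ℕ) : PTree → Prop
  | leaf _ => True
  | node q _ _ => q ≤ p

/-- Well-formed LABELS: every precision is `≥ 1` and never decreases from a child addition to its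
parent.  (This is `WF` with the leaf conditions dropped; the witness supplies the leaf values.) -/
def LabelWF : PTree → Prop
  | leaf _ => True
  | node p l r => 1 ≤ p ∧ LabOK p l ∧ LabOK p r ∧ LabelWF l ∧ LabelWF r

/-- `LabOK` at a leaf. -/
@[simp] theorem labOK_leaf (p : ℕ) (x : ℚ) : LabOK p (leaf x) := trivial
/-- `LabOK` at a node. -/
@[simp] theorem labOK_node (p q : ℕ) (l r : PTree) : LabOK p (node q l r) ↔ q ≤ p := Iff.rfl
/-- `LabelWF` at a leaf. -/
@[simp] theorem labelWF_leaf (x : ℚ) : LabelWF (leaf x) := trivial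
/-- `LabelWF` at a node, unfolded. -/
@[simp] theorem labelWF_node (p : ℕ) (l r : PTree) :
    LabelWF (node p l r) ↔ 1 ≤ p ∧ LabOK p l ∧ LabOK p r ∧ LabelWF l ∧ LabelWF r := Iff.rfl

/-- Exponent range the witness needs below the root scale: the largest sum of precisions over the
light edges of a root-leaf path (the light child at a node of precision `p` sits `p` binades lower). -/
noncomputable def dropP : PTree → ℕ
  | leaf _ => 0
  | node p a b => if treeMP U b ≤ treeMP U a then max (dropP a) (dropP b + p)
                  else max (dropP a + p) (dropP b)

/-- The witness of the labelled shape `t` at root scale `2^e`. -/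
noncomputable def witP : PTree → ℤ → PTree
  | leaf _, e => leaf ((2 : ℚ) ^ e)
  | node p a b, e => if treeMP U b ≤ treeMP U a then node p (witP a e) (witP b (e - p))
                     else node p (witP a (e - p)) (witP b e)

/-- `2^(e-p) = 2^e · u_p`. -/
theorem two_zpow_sub_prec (p : ℕ) (e : ℤ) : (2 : ℚ) ^ (e - (p : ℤ)) = (2 : ℚ) ^ e * unitRoundoff p := by
  rw [zpow_sub₀ (by norm_num : (2 : ℚ) ≠ 0), zpow_natCast]
  unfold unitRoundoff
  ring

/-- `2^e ∈ F(q, emin)` for `q ≥ 1`, `e ≥ emin`. -/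
theorem isFloat_two_zpow {q : ℕ} (hq : 1 ≤ q) {emin e : ℤ} (he : emin ≤ e) :
    IsFloat q emin ((2 : ℚ) ^ e) := by
  refine ⟨1, e, ?_, he, by simp⟩
  have h2 : (2 : ℤ) ^ 1 ≤ 2 ^ q := pow_le_pow_right₀ (by norm_num) hq
  rw [abs_one]; linarith

/-- THE WITNESS INVARIANT.  For a `LabelWF` shape `t` below precision `q ≥ 1` and a root scale `e` with
`emin + dropP t ≤ e`, under maps rounding the binade midpoints to even: the witness is `RootOK`/`WF`
for the float predicates, evaluates to `2^e`, sums exactly to `2^e · M_t`, and has the node-weighted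
polynomial of `t`. -/
theorem witP_spec {emin : ℤ} {fl : ℕ → ℚ → ℚ} (hT : ∀ p, 1 ≤ p → TiesEvenAtPow p emin (fl p)) :
    ∀ (t : PTree) (q : ℕ) (e : ℤ), LabelWF t → LabOK q t → 1 ≤ q → emin + (dropP t : ℤ) ≤ e →
      RootOK (fun p x => IsFloat p emin x) q (witP t e) ∧ WF (fun p x => IsFloat p emin x) (witP t e) ∧
      evalP fl (witP t e) = (2 : ℚ) ^ e ∧ exactP (witP t e) = (2 : ℚ) ^ e * treeMP U t ∧
      treeMP U (witP t e) = treeMP U t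
  | leaf x, q, e, _, _, hq, he => by
      simp only [dropP, Nat.cast_zero, add_zero] at he
      refine ⟨?_, ?_, ?_, ?_, ?_⟩
      · simp only [witP, rootOK_leaf]
        exact ⟨isFloat_two_zpow hq he, le_of_lt (zpow_pos (by norm_num) _)⟩
      · simp only [witP, wf_leaf]
      · simp only [witP, evalP_leaf]
      · simp only [witP, exactP_leaf, treeMP_leaf, mul_one]
      · simp only [witP, treeMP_leaf]
  | node p a b, q, e, hw, hl, hq, he => by
      rw [labelWF_node] at hw
      obtain ⟨hp, hla, hlb, hwa, hwb⟩ := hw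
      rw [labOK_node] at hl
      have hemin : emin ≤ e := by
        have : (0 : ℤ) ≤ (dropP (node p a b) : ℤ) := Int.natCast_nonneg _
        omega
      have hmid : fl p ((2 : ℚ) ^ e + (2 : ℚ) ^ e * unitRoundoff p) = (2 : ℚ) ^ e := hT p hp e hemin
      by_cases h : treeMP U b ≤ treeMP U a
      · have hd : dropP (node p a b) = max (dropP a) (dropP b + p) := by simp [dropP, if_pos h]
        rw [hd] at he
        have hea : emin + (dropP a : ℤ) ≤ e := by
          have := le_max_left (dropP a) (dropP b + p); push_cast at he ⊢; omega
        have heb : emin + (dropP b : ℤ) ≤ e - p := by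
          have := le_max_right (dropP a) (dropP b + p); push_cast at he ⊢; omega
        obtain ⟨ra, wa, va, xa, ma⟩ := witP_spec hT a p e hwa hla hp hea
        obtain ⟨rb, wb, vb, xb, mb⟩ := witP_spec hT b p (e - p) hwb hlb hp heb
        simp only [witP, if_pos h]
        refine ⟨(rootOK_node _ q p _ _).mpr hl, (wf_node _ p _ _).mpr ⟨ra, rb, wa, wb⟩, ?_, ?_, ?_⟩
        · rw [evalP_node, va, vb, two_zpow_sub_prec, hmid]
        · rw [exactP_node, xa, xb, two_zpow_sub_prec, treeMP_node, max_eq_left h, min_eq_right h,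
            U_apply]
          ring
        · rw [treeMP_node, treeMP_node, ma, mb]
      · have h' : treeMP U a ≤ treeMP U b := le_of_lt (not_le.mp h)
        have hd : dropP (node p a b) = max (dropP a + p) (dropP b) := by simp [dropP, if_neg h]
        rw [hd] at he
        have hea : emin + (dropP a : ℤ) ≤ e - p := by
          have := le_max_left (dropP a + p) (dropP b); push_cast at he ⊢; omega
        have heb : emin + (dropP b : ℤ) ≤ e := by
          have := le_max_right (dropP a + p) (dropP b); push_cast at he ⊢; omega
        obtain ⟨ra, wa, va, xa, ma⟩ := witP_spec hT a p (e - p) hwa hla hp hea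
        obtain ⟨rb, wb, vb, xb, mb⟩ := witP_spec hT b p e hwb hlb hp heb
        simp only [witP, if_neg h]
        refine ⟨(rootOK_node _ q p _ _).mpr hl, (wf_node _ p _ _).mpr ⟨ra, rb, wa, wb⟩, ?_, ?_, ?_⟩
        · rw [evalP_node, va, vb, two_zpow_sub_prec, add_comm, hmid]
        · rw [exactP_node, xa, xb, two_zpow_sub_prec, treeMP_node, max_eq_right h', min_eq_left h',
            U_apply]
          ring
        · rw [treeMP_node, treeMP_node, ma, mb]

/-- THE BOUND OF THEOREM U-MIXED IS ATTAINED (ties-to-even): for every `LabelWF` labelled shape there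
is a well-formed tree of nonnegative floats with the same node-weighted polynomial and positive exact sum
on which the computed sum under-estimates by EXACTLY `(1 - 1/M_t) · exact`. -/
theorem mixedTreePoly_bound_attained {emin : ℤ} {fl : ℕ → ℚ → ℚ}
    (hT : ∀ p, 1 ≤ p → TiesEvenAtPow p emin (fl p)) (t : PTree) (ht : LabelWF t) :
    ∃ w : PTree, treeMP U w = treeMP U t ∧ WF (fun p x => IsFloat p emin x) w ∧ 0 < exactP w ∧
      exactP w - evalP fl w = (1 - 1 / treeMP U t) * exactP w := by
  cases t with
  | leaf x => exact ⟨leaf 1, rfl, trivial, by simp, by simp⟩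
  | node p a b =>
      have hp : 1 ≤ p := ((labelWF_node p a b).mp ht).1
      obtain ⟨-, hw, hv, hx, hm⟩ := witP_spec hT (node p a b) p (emin + (dropP (node p a b) : ℤ)) ht
        ((labOK_node p p a b).mpr le_rfl) hp le_rfl
      have hM : 1 ≤ treeMP U (node p a b) := one_le_treeMP (fun q => unitRoundoff_nonneg q) _
      have h2 : (0 : ℚ) < (2 : ℚ) ^ (emin + (dropP (node p a b) : ℤ)) := zpow_pos (by norm_num) _
      refine ⟨_, hm, hw, by rw [hx]; exact mul_pos h2 (by linarith), ?_⟩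
      have hM0 : treeMP U (node p a b) ≠ 0 := by linarith
      rw [hx, hv, sub_mul, one_mul, one_div, inv_mul_eq_div, mul_div_assoc, div_self hM0, mul_one]

/-- A family of round-to-nearest maps into `F(p, emin)`, one per precision, each rounding the binade
midpoints `2^e (1+u_p)` to even (for `p ≥ 1`), exists. -/
theorem exists_roundNearest_family_tiesEven (emin : ℤ) :
    ∃ fl : ℕ → ℚ → ℚ, (∀ p, IsRoundNearest p emin (fl p)) ∧ (∀ p, 1 ≤ p → TiesEvenAtPow p emin (fl p)) := by
  classical
  have hex : ∀ p : ℕ, ∃ f : ℚ → ℚ, IsRoundNearest p emin f ∧ (1 ≤ p → TiesEvenAtPow p emin f) := by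
    intro p
    by_cases hp : 1 ≤ p
    · obtain ⟨f, hf, hT⟩ := exists_roundNearest_tiesEven hp emin
      exact ⟨f, hf, fun _ => hT⟩
    · obtain ⟨f, hf⟩ := exists_roundNearest p emin
      exact ⟨f, hf, fun h => absurd h hp⟩
  choose fl hfl using hex
  exact ⟨fl, fun p => (hfl p).1, fun p hp => (hfl p).2 hp⟩

end PTree

/-! ## Statement-level summary -/

open PTree in
/-- R4 (Opt, CM-B exact, Theorem T5(b)): SHARPNESS OF THE NODE-WEIGHTED TREE POLYNOMIAL LAW.  For every
`emin`: (i) families of round-to-nearest maps into the formats `F(p, emin)` rounding the binade midpoints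
to even exist; (ii) under every such family (in particular IEEE roundTiesToEven at every precision) and
for every labelled shape with well-formed labels there is a well-formed tree of nonnegative floats with
the same node-weighted polynomial and positive exact sum whose computed sum under-estimates by EXACTLY
`(1 - 1/M_t) · exact`.  With `R4_MixedTreePolyUnderestimation` the worst case is exactly `1 - 1/M_t`. -/
def R4_MixedTreePolySharp : Prop :=
  ∀ emin : ℤ,
    (∃ fl : ℕ → ℚ → ℚ, (∀ p, IsRoundNearest p emin (fl p)) ∧ (∀ p, 1 ≤ p → TiesEvenAtPow p emin (fl p))) ∧
    ∀ fl : ℕ → ℚ → ℚ, (∀ p, 1 ≤ p → TiesEvenAtPow p emin (fl p)) → ∀ t : PTree, LabelWF t →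
      ∃ w : PTree, treeMP U w = treeMP U t ∧ WF (fun p x => IsFloat p emin x) w ∧ 0 < exactP w ∧
        exactP w - evalP fl w = (1 - 1 / treeMP U t) * exactP w

open PTree in
/-- `R4_MixedTreePolySharp` holds. -/
theorem R4_MixedTreePolySharp_holds : R4_MixedTreePolySharp :=
  fun emin => ⟨exists_roundNearest_family_tiesEven emin,
    fun _ hT t ht => mixedTreePoly_bound_attained hT t ht⟩

end Summit.Ventures.CertifiedArithmetic.LowPrec.Opt
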